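import Mathlib.RepresentationTheory.Rep.Basic
import Mathlib.Algebra.Category.ModuleCat.Kernels
import Mathlib.CategoryTheory.Limits.Preserves.Shapes.Kernels
import HarnessLib

/-!
# The carrier of a cokernel in `Rep k G` is the quotient module: maps out of `(cokernel f).V`
# (Cassels–Fröhlich IV §1: quotient modules of `G`-modules; Mathlib's `ModuleCat.cokernelIsoRangeQuotient`)

Topic `Algebra/Homology`; namespace `Literature.Algebra.Homology.RepCokernel`.  Definitions with bodies (the carrier
isomorphism and the descent of a linear map — plumbing) and theorems; no named fact, no instance, no `sorry`.

THE POINT.  Mathlib's `Rep k G` is abelian and the abstract `cokernel f` of a morphism `f : A ⟶ B` is used in the tree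
for quotient `G`-modules whose carrier one does not want to build by hand (e.g. the `S`-idèle class layers
`C_S(E) = coker(U_{E,S} → C_E)`, `IdeleCohomology.classModUnitsRep`).  Its carrier `(cokernel f).V` is an opaque type; this
file records that it IS the quotient module `B.V ⧸ range f` (the forgetful functor `Rep k G ⥤ ModuleCat k` preserves
colimits, Mathlib `Rep.preservesColimits_forget`, and `ModuleCat.cokernelIsoRangeQuotient`), in the elementwise form a
consumer needs: **`carrierIso f : ModuleCat.of k (cokernel f).V ≅ ModuleCat.of k (B.V ⧸ range f)`** with
`carrierIso f (π x) = [x]` (`carrierIso_hom_π`), the DESCENT **`desc f g hg : (cokernel f).V →ₗ[k] N`** of a linear map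
`g : B.V →ₗ[k] N` vanishing on `range f` with `desc f g hg (π x) = g x` (`desc_π`), uniqueness (`π` is onto:
`hom_π_surjective`, `linearMap_ext_π`), and the bijectivity criteria (`desc_injective` when `ker g ≤ range f`,
`desc_surjective` when `g` is onto, `descEquiv` when both).

Written for the background lane «PT-Ш-S-TC» of cell `bsd-eis` (crux `GoodLatticeBDPValue`, stmt-BirchSwinnertonDyer-19032),
brick D2-TN (W1): the per-layer identification `C_S(E) ≅ (C̄_S)^{Gal(K_S/E)}` descends the layer map `C_E → C̄_S` through
`C_E ↠ C_S(E)`.  Seat bsd-line-x1-p1-w4 g19.  HONEST FRAMING: category-theoretic plumbing; no arithmetic content.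

## References
* J. W. S. Cassels, A. Fröhlich (eds.), *Algebraic Number Theory* (1967), Ch. IV (Atiyah–Wall) §1 (`G`-modules,
  quotient modules). [CasselsFrohlichANT1967]
* K. S. Brown, *Cohomology of Groups*, GTM 87 (1982), I §2 (the category of `G`-modules is abelian). [Brown1982CohomologyGroups]
-/

noncomputable section

open CategoryTheory CategoryTheory.Limits

universe u

namespace Literature.Algebra.Homology

namespace RepCokernel

variable {k G : Type u} [CommRing k] [Group G] {A B : Rep.{u} k G} (f : A ⟶ B)

/-- The range of `f` on vectors, as a submodule of `B.V` (for the `Module` structure carried by `B`).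
[cite: CasselsFrohlichANT1967, Ch. IV §1] -/
abbrev rangeV : Submodule k B.V := LinearMap.range f.hom.toLinearMap

/-- **The carrier of `cokernel f` is `B.V ⧸ range f`** (as `k`-modules): the forgetful functor to `ModuleCat k`
preserves cokernels (`Rep.preservesColimits_forget`) and `ModuleCat.cokernelIsoRangeQuotient`.
[cite: CasselsFrohlichANT1967, Ch. IV §1] [cite: Brown1982CohomologyGroups, I §2] -/
def carrierIso : ModuleCat.of k (cokernel f).V ≅ ModuleCat.of k (B.V ⧸ rangeV f) :=
  PreservesCokernel.iso (forget₂ (Rep.{u} k G) (ModuleCat.{u} k)) f ≪≫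
    ModuleCat.cokernelIsoRangeQuotient ((forget₂ (Rep.{u} k G) (ModuleCat.{u} k)).map f)

/-- **`carrierIso (π x) = [x]`**: the carrier isomorphism carries the class of `x ∈ B.V` in the abstract cokernel to its
class in the quotient module. [cite: CasselsFrohlichANT1967, Ch. IV §1] -/
theorem carrierIso_hom_π (x : B.V) :
    (carrierIso f).hom ((cokernel.π f).hom x) = Submodule.Quotient.mk x := by
  have h := congrArg (fun φ => (ModuleCat.Hom.hom φ) x)
    ((Category.assoc _ _ _).symm.trans
      ((congrArg (· ≫ (ModuleCat.cokernelIsoRangeQuotient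
          ((forget₂ (Rep.{u} k G) (ModuleCat.{u} k)).map f)).hom)
        (PreservesCokernel.π_iso_hom (forget₂ (Rep.{u} k G) (ModuleCat.{u} k)) f)).trans
        (ModuleCat.cokernel_π_cokernelIsoRangeQuotient_hom
          ((forget₂ (Rep.{u} k G) (ModuleCat.{u} k)).map f))))
  exact h

/-- `π : B.V → (cokernel f).V` is onto (`cokernel.π` is an epimorphism of representations).
[cite: Brown1982CohomologyGroups, I §2] -/
theorem hom_π_surjective : Function.Surjective (cokernel.π f).hom :=
  (Rep.epi_iff_surjective _).1 inferInstance

/-- `π (f a) = 0`. [cite: Brown1982CohomologyGroups, I §2] -/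
theorem hom_π_hom_apply (a : A.V) : (cokernel.π f).hom (f.hom a) = 0 := by
  have h := congrArg (fun φ => φ.hom a) (cokernel.condition f)
  simpa only [Rep.hom_comp, Representation.IntertwiningMap.comp_apply, Rep.zero_hom,
    Representation.IntertwiningMap.coe_zero, Pi.zero_apply] using h

/-- **`π x = 0 ↔ x ∈ range f`** on vectors. [cite: CasselsFrohlichANT1967, Ch. IV §1] -/
theorem hom_π_eq_zero_iff (x : B.V) : (cokernel.π f).hom x = 0 ↔ x ∈ rangeV f := by
  constructor
  · intro hx
    have h := carrierIso_hom_π f x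
    rw [hx, map_zero] at h
    exact (Submodule.Quotient.mk_eq_zero _).1 h.symm
  · rintro ⟨a, rfl⟩
    exact hom_π_hom_apply f a

/-- Two linear maps out of `(cokernel f).V` that agree on the classes `π x` are equal.
[cite: CasselsFrohlichANT1967, Ch. IV §1] -/
theorem linearMap_ext_π {N : Type u} [AddCommGroup N] [Module k N] {g g' : (cokernel f).V →ₗ[k] N}
    (h : ∀ x : B.V, g ((cokernel.π f).hom x) = g' ((cokernel.π f).hom x)) : g = g' :=
  LinearMap.ext fun y => by
    obtain ⟨x, rfl⟩ := hom_π_surjective f y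
    exact h x

variable {N : Type u} [AddCommGroup N] [Module k N] (g : B.V →ₗ[k] N) (hg : ∀ a : A.V, g (f.hom a) = 0)

include hg in
/-- `range f ≤ ker g` in submodule form. [cite: CasselsFrohlichANT1967, Ch. IV §1] -/
theorem rangeV_le_ker : rangeV f ≤ LinearMap.ker g := by
  rintro _ ⟨a, rfl⟩
  exact hg a

/-- **The descent of `g : B.V → N` vanishing on `range f` to the cokernel carrier** (`liftQ` after `carrierIso`).
[cite: CasselsFrohlichANT1967, Ch. IV §1] -/
def desc : (cokernel f).V →ₗ[k] N :=
  (rangeV f).liftQ g (rangeV_le_ker f g hg) ∘ₗ (carrierIso f).hom.hom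

/-- **`desc g (π x) = g x`.** [cite: CasselsFrohlichANT1967, Ch. IV §1] -/
theorem desc_π (x : B.V) : desc f g hg ((cokernel.π f).hom x) = g x := by
  change (rangeV f).liftQ g (rangeV_le_ker f g hg) ((carrierIso f).hom ((cokernel.π f).hom x)) = g x
  rw [carrierIso_hom_π]
  rfl

/-- `desc g` is the unique linear map with `desc g ∘ π = g`. [cite: CasselsFrohlichANT1967, Ch. IV §1] -/
theorem desc_unique (g' : (cokernel f).V →ₗ[k] N) (h : ∀ x : B.V, g' ((cokernel.π f).hom x) = g x) :
    g' = desc f g hg :=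
  linearMap_ext_π f fun x => (h x).trans (desc_π f g hg x).symm

/-- **`desc g` is injective when `ker g ≤ range f`.** [cite: CasselsFrohlichANT1967, Ch. IV §1] -/
theorem desc_injective (hker : ∀ x : B.V, g x = 0 → x ∈ rangeV f) : Function.Injective (desc f g hg) := by
  refine (injective_iff_map_eq_zero _).2 fun y hy => ?_
  obtain ⟨x, rfl⟩ := hom_π_surjective f y
  rw [desc_π] at hy
  exact (hom_π_eq_zero_iff f x).2 (hker x hy)

/-- **`desc g` is surjective when `g` is.** [cite: CasselsFrohlichANT1967, Ch. IV §1] -/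
theorem desc_surjective (hsurj : Function.Surjective g) : Function.Surjective (desc f g hg) := fun n => by
  obtain ⟨x, rfl⟩ := hsurj n
  exact ⟨(cokernel.π f).hom x, desc_π f g hg x⟩

/-- **The carrier of `cokernel f` is `N`** when `g : B.V ↠ N` is onto with kernel `range f`: the linear equivalence
`(cokernel f).V ≃ₗ[k] N` with `descEquiv (π x) = g x`. [cite: CasselsFrohlichANT1967, Ch. IV §1] -/
def descEquiv (hker : ∀ x : B.V, g x = 0 → x ∈ rangeV f) (hsurj : Function.Surjective g) :
    (cokernel f).V ≃ₗ[k] N :=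
  LinearEquiv.ofBijective (desc f g hg) ⟨desc_injective f g hg hker, desc_surjective f g hg hsurj⟩

/-- `descEquiv (π x) = g x`. [cite: CasselsFrohlichANT1967, Ch. IV §1] -/
theorem descEquiv_π (hker : ∀ x : B.V, g x = 0 → x ∈ rangeV f) (hsurj : Function.Surjective g) (x : B.V) :
    descEquiv f g hg hker hsurj ((cokernel.π f).hom x) = g x :=
  desc_π f g hg x

/-- `descEquiv⁻¹ (g x) = π x`. [cite: CasselsFrohlichANT1967, Ch. IV §1] -/
theorem descEquiv_symm_apply (hker : ∀ x : B.V, g x = 0 → x ∈ rangeV f) (hsurj : Function.Surjective g) (x : B.V) :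
    (descEquiv f g hg hker hsurj).symm (g x) = (cokernel.π f).hom x :=
  (LinearEquiv.symm_apply_eq _).2 (descEquiv_π f g hg hker hsurj x).symm

/-- **Equivariance of the descent**: if `g` intertwines the action of `γ ∈ G` on `B` with an endomorphism `τ` of `N`
(`g (γ • x) = τ (g x)`), then so does `desc g` on the cokernel (`desc g (γ • y) = τ (desc g y)`), the cokernel carrying the
quotient action. [cite: CasselsFrohlichANT1967, Ch. IV §1] -/
theorem desc_ρ_apply (γ : G) (τ : N →ₗ[k] N) (hτ : ∀ x : B.V, g (B.ρ γ x) = τ (g x)) (y : (cokernel f).V) :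
    desc f g hg ((cokernel f).ρ γ y) = τ (desc f g hg y) := by
  obtain ⟨x, rfl⟩ := hom_π_surjective f y
  rw [← Rep.hom_comm_apply (cokernel.π f) γ x, desc_π, desc_π, hτ]

end RepCokernel

end Literature.Algebra.Homology

end
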